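import Summits.QuantumFields.YangMills.Theorems.F4SubCurvatureDoorLaplaceFourierRegistered
import Mathlib
import HarnessLib

/-!
# Stub S1 «FORWARD-CONE SUPPORT» — NATIVE 4-D PLAN: rungs BY NAME + a PROVED reduction (registry unchanged; no stubs; v5: + CrossAnalyticity, LukacsOneDim, QuantitativeCrossAnalyticity, PringsheimIdentification, DiagonalGain; proved glue initialAperture_of_linearAperture)

S1 `stub_forwardConeSupport : ForwardConeSupport` is the XL obligation shared by LINES g21-A `shell_separation` and g21-B `fibre_dichotomy`
(crux ⟨stmt-QuantumFields-23125⟩).  This file records the 4-D NATIVE version of `angular_type`'s (C)-plan (which lives in ONE hexagonal 2-plane):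
at a point of the positive time axis the class kernel extends holomorphically in NINE real directions separately (the time axis and the eight
half-integer short roots `(1, ±1, ±1, ±1)/2`, all with positive inner product with `e₀`; each extension is the Laplace–Fourier integral in that root's
frame, R-S1∂), and nine directions span `ℝ⁴`; the cross theorem for separately holomorphic functions (Bernstein–Siciak) then gives JOINT holomorphy near
the time axis, in particular analyticity of the positive-definite function `x⃗ ↦ K(t, x⃗)` AT `x⃗ = 0`, hence (multivariate Lukacs) spatial exponential
moments of `e^{−tE}μ` (R-S1a) with an aperture LINEAR in `t` by dilation invariance of the class, and a bound by the axis function (R-S1b); pinning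
`t → ∞` (R-S1c, pure measure theory) gives an INITIAL CONE `E ≥ κ₀|q⃗|`; the APERTURE BOOTSTRAP (R-S1d: a cone of aperture `κ < 1` for every class kernel
enlarges the 24 frame tubes, whose envelope gives aperture `κ' > κ`) and the proved supremum argument `forwardConeSupport_of_aperture` below close S1.
This removes the «irrational 2-planes» obstruction of a plane-by-plane transfer: no 2-plane other than the hexagonal ones carries more than one RP
direction, but the time AXIS sees nine.

Nothing here is an obligation of a line; no summit, rung or crux is proved by this file.  Land rungs as `theorem <name>_holds : <Name>` restated
character-identically in a `Theorems/` file, `--supports stmt-QuantumFields-23125 --as helper` (namespace last component ≠ decl names).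
Sources: cross theorem [Siciak, Ann. Polon. Math. 22 (1969); Jarnicki–Pflug, Extension of Holomorphic Functions (2000) — not held; corpus: Hörmander 1973
Thm 2.5.10 (tube), p.129]; analytic characteristic functions [Cuppens 1975 Ch. 3, pp. 40–48; Lukacs 1970 §7]; `angular_type.md` (C)-plan S1–S4.
-/

set_option autoImplicit false

noncomputable section

namespace Summit.QuantumFields.YangMills.Cruxes.RationalToGeneral.ForwardConeRungs

open scoped Topology BigOperators
open Filter Set MeasureTheory
open Literature.MathematicalPhysics.QuantumLattice (siteToE)
open Summit.QuantumFields.YangMills.Theorems.F4SubCurvatureDoorLaplaceFourierRegistered (E4 E3 InClass timeSpace IsLF)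

/-- `R` preserves the even lattice `D₄` (verbatim from `Lines/fibre_dichotomy.lean`). -/
def IsD4Isometry (R : E4 ≃ₗᵢ[ℝ] E4) : Prop :=
  ∀ z : Fin 4 → ℤ, Even (∑ i, z i) → ∃ w : Fin 4 → ℤ, Even (∑ i, w i) ∧ R (siteToE z) = siteToE w

/-- Stub S1 «FORWARD-CONE SUPPORT» (verbatim from `Lines/shell_separation.lean` / `Lines/fibre_dichotomy.lean`). -/
def ForwardConeSupport : Prop :=
  ∀ K : E4 → ℝ, InClass K → ∀ μ : Measure (ℝ × E3), IsLF K μ → μ {p | p.1 < ‖p.2‖} = 0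

/-! ## Rungs -/

/-- R-S1∂ «DIRECTIONAL EXTENSION» (S–M): in the frame of any short root `u = R e₀`, the class kernel extends holomorphically in the complex
`u`-direction over the half-space `x·u > 0`, bounded by the axis function.  (The Laplace–Fourier integral read in the `u`-frame: `R⁻¹ u = e₀` has no
spatial part, so only the time argument becomes complex.) -/
def DirectionalExtension : Prop :=
  ∀ (K : E4 → ℝ) (μ : Measure (ℝ × E3)), InClass K → IsLF K μ →
    ∀ R : E4 ≃ₗᵢ[ℝ] E4, IsD4Isometry R → ∀ x : E4, 0 < inner ℝ x (R (timeSpace 1 0)) →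
      ∃ F : ℂ → ℂ, DifferentiableOn ℂ F {w : ℂ | -(inner ℝ x (R (timeSpace 1 0))) < w.re} ∧
        (∀ a : ℝ, -(inner ℝ x (R (timeSpace 1 0))) < a → F (a : ℂ) = ((K (x + a • R (timeSpace 1 0)) : ℝ) : ℂ)) ∧
        (∀ w : ℂ, -(inner ℝ x (R (timeSpace 1 0))) < w.re →
            ‖F w‖ ≤ K (timeSpace (inner ℝ x (R (timeSpace 1 0)) + w.re) 0))

/-- R-S1a «SPATIAL EXPONENTIAL MOMENTS» (M–L; cross theorem at the time axis + multivariate Lukacs). -/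
def SpatialExponentialMoments : Prop :=
  ∀ (K : E4 → ℝ) (μ : Measure (ℝ × E3)), InClass K → IsLF K μ →
    ∀ t : ℝ, 0 < t → ∃ δ : ℝ, 0 < δ ∧ Integrable (fun p : ℝ × E3 => Real.exp (-(t * p.1) + δ * ‖p.2‖)) μ

/-- R-S1b «LINEAR APERTURE WITH AXIS BOUND» (L; dilation invariance of the class makes the aperture linear in `t`; the cross-theorem extension is
bounded by the directional bounds, i.e. by the axis function at a fixed fraction of `t`). -/
def LinearAperture : Prop :=
  ∃ κ c C₀ : ℝ, 0 < κ ∧ 0 < c ∧ 0 < C₀ ∧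
    ∀ (K : E4 → ℝ) (μ : Measure (ℝ × E3)), InClass K → IsLF K μ →
      ∀ t : ℝ, 0 < t →
        Integrable (fun p : ℝ × E3 => Real.exp (-(t * p.1) + κ * t * ‖p.2‖)) μ ∧
        ∫ p : ℝ × E3, Real.exp (-(t * p.1) + κ * t * ‖p.2‖) ∂μ ≤ C₀ * K (timeSpace (c * t) 0)

/-- R-S1c «CONE PINNING» (S–M, pure measure theory): a `t`-uniform bound on `∫ e^{−t(E − κ|q⃗|)} dμ` for large `t` forces `E ≥ κ|q⃗|` a.e. -/
def ConePinning : Prop :=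
  ∀ (μ : Measure (ℝ × E3)) (κ : ℝ), 0 < κ →
    (∃ C t₀ : ℝ, ∀ t : ℝ, t₀ ≤ t →
        Integrable (fun p : ℝ × E3 => Real.exp (-(t * p.1) + κ * t * ‖p.2‖)) μ ∧
        ∫ p : ℝ × E3, Real.exp (-(t * p.1) + κ * t * ‖p.2‖) ∂μ ≤ C) →
    μ {p | p.1 < κ * ‖p.2‖} = 0

/-- «INITIAL APERTURE» (= R-S1b + R-S1c + boundedness of the axis function outside the unit ball): a universal cone `E ≥ κ₀ |q⃗|`. -/
def InitialAperture : Prop :=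
  ∃ κ : ℝ, 0 < κ ∧ ∀ (K : E4 → ℝ) (μ : Measure (ℝ × E3)), InClass K → IsLF K μ → μ {p | p.1 < κ * ‖p.2‖} = 0

/-- R-S1d «APERTURE BOOTSTRAP» (L; the several-complex-variables heart — 4-D analogue of `angular_type`'s equal-aperture edge bootstrap S3): a cone of
aperture `κ < 1` valid for EVERY class kernel improves to some `κ' > κ` (the 24 frame tubes of aperture `κ` have an envelope of holomorphy containing the
frame tubes of aperture `κ'`; then Lukacs + pinning as in R-S1a–c).  WHY IT MIGHT FAIL: the envelope gain `κ' − κ` could vanish before `κ = 1` only if a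
`W(F₄)`-symmetric, RP, non-Lorentzian dispersion existed — which is what S1 denies; honest open point. -/
def ApertureBootstrap : Prop :=
  ∀ κ : ℝ, 0 < κ → κ < 1 → ∃ κ' : ℝ, κ < κ' ∧
    ∀ (K : E4 → ℝ) (μ : Measure (ℝ × E3)), InClass K → IsLF K μ →
      μ {p | p.1 < κ * ‖p.2‖} = 0 → μ {p | p.1 < κ' * ‖p.2‖} = 0

/-! ## v2: the two classical imports of `InitialAperture`, typed as self-contained rungs -/

/-- R-S1× «CROSS ANALYTICITY» (M–L; Bernstein–Siciak, specialised): a continuous function near `x₀ ∈ ℝ⁴` which, at every nearby point and along each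
of four linearly independent directions, extends holomorphically to a disc of FIXED radius with a UNIFORM bound, is real-analytic at `x₀`.  (Linear change
of coordinates to the frame `v`; then the classical lemma on separately holomorphic functions on a real cube with uniform bounded extensions —
Lagrange interpolation / Bernstein–Walsh.)  Used with `v = (e₀, three half-integer short roots)` at points of the positive time axis, fed by
`DirectionalExtension` (radius `t/4`, bound `sup_{[t/4, 2t]}` of the axis function). -/
def CrossAnalyticity : Prop :=
  ∀ (f : E4 → ℝ) (x₀ : E4) (v : Fin 4 → E4), LinearIndependent ℝ v →
    ∀ (r M ε : ℝ), 0 < r → 0 < ε → ContinuousOn f (Metric.ball x₀ ε) →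
      (∀ x : E4, dist x x₀ < ε → ∀ j : Fin 4, ∃ F : ℂ → ℂ, DifferentiableOn ℂ F (Metric.ball 0 r) ∧
          (∀ a : ℝ, |a| < r → F (a : ℂ) = ((f (x + a • v j) : ℝ) : ℂ)) ∧ ∀ w ∈ Metric.ball (0 : ℂ) r, ‖F w‖ ≤ M) →
      AnalyticAt ℝ f x₀

/-- R-S1ℓ «LUKACS, ONE-DIMENSIONAL» (M; [Lukacs 1970, Thm 7.1.1]; elementary: analyticity of the cosine transform at `0` bounds the even moments by
`C (2k)!/ρ^{2k}`, and `∫ cosh(δq) dm = Σ m_{2k} δ^{2k}/(2k)!` by Tonelli): a finite positive measure on `ℝ` whose cosine transform is real-analytic at `0`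
has an exponential moment.  The three spatial coordinate directions + Hölder then give `SpatialExponentialMoments` from analyticity of `x⃗ ↦ K(t, x⃗)` at
`x⃗ = 0` (which is `CrossAnalyticity` ∘ `DirectionalExtension`). -/
def LukacsOneDim : Prop :=
  ∀ (m : Measure ℝ), IsFiniteMeasure m → ∀ φ : ℝ → ℝ, (∀ s : ℝ, φ s = ∫ q, Real.cos (s * q) ∂m) → AnalyticAt ℝ φ 0 →
    ∃ δ : ℝ, 0 < δ ∧ Integrable (fun q : ℝ => Real.exp (δ * |q|)) m

/-- R-S1×⁺ «QUANTITATIVE CROSS THEOREM» (L; Siciak's explicit extension domain `X̂ = {Σ_j h_j(z_j) < 1}` is scale-covariant and the extension obeys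
the two-constants bound `‖f̂‖_X̂ ≤ ‖f‖_X`): same hypotheses as `CrossAnalyticity` with `ε = r`, conclusion a holomorphic extension to the complex
ball of radius `c·r` about `x₀` with the SAME bound `M`, `c > 0` depending only on the frame `v`.  This (not the qualitative `CrossAnalyticity`) is what
`LinearAperture` needs: at `x₀ = t e₀` the data of `DirectionalExtension` have `r ≍ t` and `M = sup_{[t/8, 2t]}` of the axis function `= L_μ(t/8)`
(monotone), so `y⃗ ↦ K(t, iy⃗)` is bounded by `L_μ(t/8)` for `|y⃗| < c' t`, and Vivanti–Pringsheim (non-negative even Taylor coefficients) identifies it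
with `∫ e^{−tE} cosh(q⃗·y⃗) dμ`. -/
def QuantitativeCrossAnalyticity : Prop :=
  ∀ (v : Fin 4 → E4), LinearIndependent ℝ v → ∃ c : ℝ, 0 < c ∧
    ∀ (f : E4 → ℝ) (x₀ : E4) (r M : ℝ), 0 < r → ContinuousOn f (Metric.ball x₀ r) →
      (∀ x : E4, dist x x₀ < r → ∀ j : Fin 4, ∃ F : ℂ → ℂ, DifferentiableOn ℂ F (Metric.ball 0 r) ∧
          (∀ a : ℝ, |a| < r → F (a : ℂ) = ((f (x + a • v j) : ℝ) : ℂ)) ∧ ∀ w ∈ Metric.ball (0 : ℂ) r, ‖F w‖ ≤ M) →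
      ∃ G : (Fin 4 → ℂ) → ℂ, DifferentiableOn ℂ G (Metric.ball (fun i => ((x₀ i : ℝ) : ℂ)) (c * r)) ∧
        (∀ x : E4, dist x x₀ < c * r → G (fun i => ((x i : ℝ) : ℂ)) = ((f x : ℝ) : ℂ)) ∧
        ∀ z ∈ Metric.ball (fun i => ((x₀ i : ℝ) : ℂ)) (c * r), ‖G z‖ ≤ M

/-- «PRINGSHEIM IDENTIFICATION» (M; Vivanti–Pringsheim for cosine transforms of positive measures, three variables): if the spatial slice
`x⃗ ↦ K(t, x⃗) = ∫ e^{−tE} cos(q⃗·x⃗) dμ` is the restriction of a function holomorphic and bounded by `M` on the complex sup-ball of radius `ρ` about `0`,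
then the exponential moments up to aperture `ρ` exist and are bounded by `2M` along every coordinate direction. -/
def PringsheimIdentification : Prop :=
  ∀ (μ : Measure (ℝ × E3)) (t ρ M : ℝ), 0 < t → 0 < ρ →
    Integrable (fun p : ℝ × E3 => Real.exp (-(t * p.1))) μ →
    (∃ G : (Fin 3 → ℂ) → ℂ, DifferentiableOn ℂ G (Metric.ball 0 ρ) ∧ (∀ z ∈ Metric.ball (0 : Fin 3 → ℂ) ρ, ‖G z‖ ≤ M) ∧
        ∀ y : Fin 3 → ℝ, (∀ j, |y j| < ρ) →
          G (fun j => ((y j : ℝ) : ℂ)) = ((∫ p : ℝ × E3, Real.exp (-(t * p.1)) * Real.cos (∑ j, p.2 j * y j) ∂μ : ℝ) : ℂ)) →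
    ∀ (j : Fin 3) (δ : ℝ), 0 < δ → δ < ρ →
      Integrable (fun p : ℝ × E3 => Real.exp (-(t * p.1) + δ * |p.2 j|)) μ ∧
      ∫ p : ℝ × E3, Real.exp (-(t * p.1) + δ * |p.2 j|) ∂μ ≤ 2 * M

/-- R-S1e «DIAGONAL GAIN» (L; the FIRST step of the bootstrap, where the engine is visible): a round cone of aperture `κ < 1` for a class kernel
improves along the eight DIAGONAL momentum directions `s⃗/√3`, `s⃗ ∈ {±1}³`.  ENGINE (g21 analysis, see `Ideas/s1-native-cross.md` §Bootstrap engine): at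
the point `p⋆ = (t, iκt s⃗/√3)` three frame tubes are simultaneously tangent — `T₀(κ)` and `T_u(κ)`, `T_{u'}(κ)` for `u, u' = (1, ±s⃗)/2` — and their
tangent complex functionals `ℓ₀ = κ z₀ + i n⃗·z⃗`, `ℓ_u = (κ/2 − i√3/2) z₀ + (κ√3/2 + i/2) n⃗·z⃗` are `ℂ`-proportional iff `κ² = 1` (the 4-D analogue
of `angular_type`'s `(τ² − 1)`); for `κ < 1` the union is locally a tube over a non-convex base in the coordinates `(ℓ₀, ℓ_u, ·, ·)` up to curvature
`O(ε²)`, so the local Bochner tube theorem continues `K` across `p⋆`, and Vivanti–Pringsheim at real time converts that into exponential moments beyond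
`κt` in the direction `s⃗/√3`; pinning as in `ConePinning`.  At the AXIS directions `±e_j` only `T₀` is active (no edge), so the first step gains
nothing there — the iteration lives on `W(B₃)`-symmetric convex bodies, not on round cones (honest open point of `ApertureBootstrap`). -/
def DiagonalGain : Prop :=
  ∀ κ : ℝ, 0 < κ → κ < 1 → ∃ κ' c C₀ : ℝ, κ < κ' ∧ 0 < c ∧ 0 < C₀ ∧
    ∀ (K : E4 → ℝ) (μ : Measure (ℝ × E3)), InClass K → IsLF K μ → μ {p | p.1 < κ * ‖p.2‖} = 0 →
      ∀ (sgn : Fin 3 → Bool) (t : ℝ), 0 < t →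
        Integrable (fun p : ℝ × E3 =>
          Real.exp (-(t * p.1) + κ' * t * |∑ j, (if sgn j then (1 : ℝ) else -1) * p.2 j| / Real.sqrt 3)) μ ∧
        ∫ p : ℝ × E3, Real.exp (-(t * p.1) + κ' * t * |∑ j, (if sgn j then (1 : ℝ) else -1) * p.2 j| / Real.sqrt 3) ∂μ
          ≤ C₀ * K (timeSpace (c * t) 0)

/-! ## Proved reduction: initial aperture + bootstrap ⇒ S1 (supremum argument) -/

/-- Apertures pass to suprema: if every `κ' < κ⋆` (with `0 < κ'`) is an aperture of `μ`, so is `κ⋆`. -/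
theorem aperture_of_forall_lt (μ : Measure (ℝ × E3)) (κs : ℝ)
    (h : ∀ κ' : ℝ, 0 < κ' → κ' < κs → μ {p | p.1 < κ' * ‖p.2‖} = 0) :
    μ {p : ℝ × E3 | p.1 < κs * ‖p.2‖} ≤ μ {p : ℝ × E3 | p.1 < 0} := by
  -- cover `{E < κ⋆|q⃗|}` by `{E < 0}` and the countable union over rational apertures below `κ⋆`
  have hcov : {p : ℝ × E3 | p.1 < κs * ‖p.2‖} ⊆
      {p : ℝ × E3 | p.1 < 0} ∪ ⋃ (r : ℚ), {p : ℝ × E3 | 0 < (r : ℝ) ∧ (r : ℝ) < κs ∧ p.1 < (r : ℝ) * ‖p.2‖} := by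
    intro p hp
    simp only [Set.mem_setOf_eq] at hp
    by_cases hneg : p.1 < 0
    · exact Or.inl hneg
    · right
      rw [not_lt] at hneg
      have hq : 0 < ‖p.2‖ := by
        rcases lt_or_eq_of_le (norm_nonneg p.2) with hlt | heq
        · exact hlt
        · exfalso; rw [← heq, mul_zero] at hp; linarith
      have hks : p.1 / ‖p.2‖ < κs := by rwa [div_lt_iff₀ hq]
      obtain ⟨r, hr1, hr2⟩ := exists_rat_btwn (max_lt hks (show (0 : ℝ) < κs by
        have : 0 ≤ p.1 / ‖p.2‖ := div_nonneg hneg (le_of_lt hq); linarith))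
      refine Set.mem_iUnion.mpr ⟨r, ?_⟩
      simp only [Set.mem_setOf_eq]
      refine ⟨lt_of_le_of_lt (le_max_right _ _) hr1, hr2, ?_⟩
      have h1 : p.1 / ‖p.2‖ < r := lt_of_le_of_lt (le_max_left _ _) hr1
      rwa [div_lt_iff₀ hq] at h1
  calc μ {p : ℝ × E3 | p.1 < κs * ‖p.2‖}
      ≤ μ ({p : ℝ × E3 | p.1 < 0} ∪ ⋃ (r : ℚ), {p : ℝ × E3 | 0 < (r : ℝ) ∧ (r : ℝ) < κs ∧ p.1 < (r : ℝ) * ‖p.2‖}) :=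
        measure_mono hcov
    _ ≤ μ {p : ℝ × E3 | p.1 < 0} + μ (⋃ (r : ℚ), {p : ℝ × E3 | 0 < (r : ℝ) ∧ (r : ℝ) < κs ∧ p.1 < (r : ℝ) * ‖p.2‖}) :=
        measure_union_le _ _
    _ ≤ μ {p : ℝ × E3 | p.1 < 0} + 0 := by
        gcongr
        refine le_of_eq (measure_iUnion_null_iff.mpr fun r => ?_)
        by_cases hr : 0 < (r : ℝ) ∧ (r : ℝ) < κs
        · have := h r hr.1 hr.2
          refine measure_mono_null (fun p hp => ?_) this
          simp only [Set.mem_setOf_eq] at hp ⊢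
          exact hp.2.2
        · refine measure_mono_null (fun p hp => ?_) (measure_empty (μ := μ))
          simp only [Set.mem_setOf_eq] at hp
          exact hr ⟨hp.1, hp.2.1⟩
    _ = μ {p : ℝ × E3 | p.1 < 0} := add_zero _

/-- A Laplace–Fourier measure has no negative energies. -/
theorem energy_nonneg_null (K : E4 → ℝ) (μ : Measure (ℝ × E3)) (hμ : IsLF K μ) :
    μ {p : ℝ × E3 | p.1 < 0} = 0 := by
  have h := hμ.1
  have hset : {p : ℝ × E3 | p.1 < 0} = Set.Iio (0 : ℝ) ×ˢ (Set.univ : Set E3) := by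
    ext p; simp [Set.mem_prod]
  rw [hset]; exact h

/-- **PROVED REDUCTION**: a universal initial aperture and the aperture bootstrap give S1 `ForwardConeSupport` (supremum argument). -/
theorem forwardConeSupport_of_aperture (h0 : InitialAperture) (hb : ApertureBootstrap) : ForwardConeSupport := by
  intro K hK μ hμ
  -- the set of universal apertures in (0, 1]
  set S : Set ℝ := {κ : ℝ | 0 < κ ∧ κ ≤ 1 ∧
    ∀ (K' : E4 → ℝ) (μ' : Measure (ℝ × E3)), InClass K' → IsLF K' μ' → μ' {p | p.1 < κ * ‖p.2‖} = 0} with hS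
  obtain ⟨κ₀, hκ₀, hA₀⟩ := h0
  -- `min κ₀ 1 ∈ S`
  have hmono : ∀ (κ₁ κ₂ : ℝ), κ₁ ≤ κ₂ → ∀ (μ' : Measure (ℝ × E3)),
      μ' {p | p.1 < κ₂ * ‖p.2‖} = 0 → μ' {p | p.1 < κ₁ * ‖p.2‖} = 0 := by
    intro κ₁ κ₂ hle μ' h2
    refine measure_mono_null (fun p hp => ?_) h2
    simp only [Set.mem_setOf_eq] at hp ⊢
    exact lt_of_lt_of_le hp (mul_le_mul_of_nonneg_right hle (norm_nonneg _))
  have hmem : min κ₀ 1 ∈ S := by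
    refine ⟨lt_min hκ₀ one_pos, min_le_right _ _, fun K' μ' hK' hμ' => ?_⟩
    exact hmono _ _ (min_le_left _ _) μ' (hA₀ K' μ' hK' hμ')
  have hne : S.Nonempty := ⟨_, hmem⟩
  have hbdd : BddAbove S := ⟨1, fun κ hκ => hκ.2.1⟩
  set κs := sSup S with hκs
  have hκs_le : κs ≤ 1 := csSup_le hne (fun κ hκ => hκ.2.1)
  have hκs_pos : 0 < κs := lt_of_lt_of_le (lt_min hκ₀ one_pos) (le_csSup hbdd hmem)
  -- every κ' < κ⋆ with 0 < κ' is a universal aperture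
  have hbelow : ∀ κ' : ℝ, 0 < κ' → κ' < κs →
      ∀ (K' : E4 → ℝ) (μ' : Measure (ℝ × E3)), InClass K' → IsLF K' μ' → μ' {p | p.1 < κ' * ‖p.2‖} = 0 := by
    intro κ' hκ' hlt K' μ' hK' hμ'
    obtain ⟨κ, hκS, hκ'κ⟩ := exists_lt_of_lt_csSup hne hlt
    exact hmono _ _ (le_of_lt hκ'κ) μ' (hκS.2.2 K' μ' hK' hμ')
  -- hence κ⋆ itself is a universal aperture
  have hstar : ∀ (K' : E4 → ℝ) (μ' : Measure (ℝ × E3)), InClass K' → IsLF K' μ' →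
      μ' {p | p.1 < κs * ‖p.2‖} = 0 := by
    intro K' μ' hK' hμ'
    have := aperture_of_forall_lt μ' κs (fun κ' hκ' hlt => hbelow κ' hκ' hlt K' μ' hK' hμ')
    rw [energy_nonneg_null K' μ' hμ'] at this
    exact le_antisymm this bot_le
  -- κ⋆ = 1, else the bootstrap contradicts maximality
  have hκs_one : κs = 1 := by
    by_contra hne1
    have hlt1 : κs < 1 := lt_of_le_of_ne hκs_le hne1
    obtain ⟨κ', hκ', hA'⟩ := hb κs hκs_pos hlt1
    have hmem' : min κ' 1 ∈ S := by
      refine ⟨lt_min (lt_trans hκs_pos hκ') one_pos, min_le_right _ _, fun K' μ' hK' hμ' => ?_⟩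
      exact hmono _ _ (min_le_left _ _) μ' (hA' K' μ' hK' hμ' (hstar K' μ' hK' hμ'))
    have : min κ' 1 ≤ κs := le_csSup hbdd hmem'
    have : κs < min κ' 1 := lt_min hκ' hlt1
    linarith
  have := hstar K μ hK hμ
  rw [hκs_one] at this
  simpa only [one_mul] using this

/-! ## v4: proved glue `LinearAperture → ConePinning → InitialAperture` -/

/-- The norm of an axis point. -/
theorem norm_timeSpace_zero (s : ℝ) : ‖timeSpace s 0‖ = |s| := by
  have h : timeSpace s 0 = EuclideanSpace.single (0 : Fin 4) s := by
    ext i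
    simp only [timeSpace, WithLp.equiv_symm_apply, EuclideanSpace.single_apply]
    refine Fin.cases ?_ (fun j => ?_) i
    · simp
    · simp [Fin.succ_ne_zero]
  rw [h, EuclideanSpace.norm_single, Real.norm_eq_abs]

/-- **PROVED GLUE**: the linear aperture with axis bound, cone pinning and the class's boundedness outside the unit ball give a universal
initial aperture.  With `forwardConeSupport_of_aperture`: `S1 ⇐ LinearAperture ∧ ConePinning ∧ ApertureBootstrap`. -/
theorem initialAperture_of_linearAperture (hL : LinearAperture) (hP : ConePinning) : InitialAperture := by
  obtain ⟨κ, c, C₀, hκ, hc, hC₀, h⟩ := hL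
  refine ⟨κ, hκ, fun K μ hK hμ => ?_⟩
  obtain ⟨CK, hCK⟩ := hK.2.1
  refine hP μ κ hκ ⟨C₀ * CK, max 1 (1 / c), fun t ht => ?_⟩
  have ht1 : 1 ≤ t := le_trans (le_max_left _ _) ht
  have htpos : 0 < t := lt_of_lt_of_le one_pos ht1
  have hct : 1 ≤ c * t := by
    have : 1 / c ≤ t := le_trans (le_max_right _ _) ht
    have h1 : 1 ≤ c * t := by
      have := mul_le_mul_of_nonneg_left this hc.le
      rwa [mul_one_div_cancel hc.ne'] at this
    exact h1
  obtain ⟨hint, hbound⟩ := h K μ hK hμ t htpos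
  refine ⟨hint, le_trans hbound ?_⟩
  have hnorm : 1 ≤ ‖timeSpace (c * t) 0‖ := by
    rw [norm_timeSpace_zero, abs_of_pos (mul_pos hc htpos)]; exact hct
  have hKle : K (timeSpace (c * t) 0) ≤ CK := le_trans (le_abs_self _) (hCK _ hnorm)
  exact mul_le_mul_of_nonneg_left hKle hC₀.le

/-- **S1 modulo three named statements** (kernel-checked bookkeeping of the programme). -/
theorem forwardConeSupport_of_linearAperture (hL : LinearAperture) (hP : ConePinning) (hb : ApertureBootstrap) :
    ForwardConeSupport :=
  forwardConeSupport_of_aperture (initialAperture_of_linearAperture hL hP) hb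

end Summit.QuantumFields.YangMills.Cruxes.RationalToGeneral.ForwardConeRungs

end
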